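import Literature.AlgebraicGeometry.HodgeTheory.NodalPencilLocalFibre
import HarnessLib

/-!
# The local Milnor fibre of a pencil member near an isolated singular point of Pham–Brieskorn type (arbitrary weights):
# a homeomorphism onto a cut Pham–Brieskorn fibre, bijective on homology

Family `hodge`, layer `Literature/AlgebraicGeometry/HodgeTheory`; theorems only (no definition, no named fact). Written by the
prover seat `hodge-nonav-20241-p1` (g19, cell `hodge-nonav`) as brick 5 of the port B4c of the programme «A₃-TRACE» (memo
`HOME/memos/PROGRAMME-A3-TRACE-Bx-g16.md` §3; binder hN `stub_a3NonComm` of crux K1-B `VeryGeneralSignCommutatorsInHg`,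
stmt-HodgeConjecture-19716): the WEIGHTED twin of prover-Bx's `NodalPencilLocalFibre` (all weights `2`), with the homological conclusion
upgraded from «injective on `H_k(·; ℚ)`» to «BIJECTIVE on `H_k(·; M)` for every coefficient module `M` over every commutative ring `R`»
(the shape `hbij` consumed over `ℂ` by prover-Bx's `SymmetricA3NonCommutationOfLocalisation.symmetricA3NonCommutation_of_localisedRotation`).

For a weight vector `a : Fin (n + 1) → ℕ` (all `aⱼ ≠ 0`), a chart `Θ` with `Σⱼ (Θ y)ⱼ^{aⱼ} = φ(y)`, a member
`X_c = NodalPencil.pencilFibre n d i b₀ c` (`c ≠ 0` small) of the pencil read in the regular locus `𝒴°(ℂ)`, and the part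
`A = X_c ∩ {F < T'}` of it inside the chart ball (`F = NodalPencil.satRadius`), the map

  `e : A → F_a = {Σ zⱼ^{aⱼ} = 1}`,  `e(Q)ⱼ = Θ(y(Q))ⱼ / λⱼ`  (`λⱼ^{aⱼ} = c`)

(chart coordinates followed by Milnor's rescaling of the local fibre `{Σ wⱼ^{aⱼ} = c}` to `{Σ zⱼ^{aⱼ} = 1}`, Milnor §9 Lemma 9.4) is a
HOMEOMORPHISM onto the cut fibre `F_a ∩ E`, `E = {Σ |λⱼ|² |zⱼ|² < T'}` (inverse `z ↦ Φ⁻¹(b'₀, Θ⁻¹(λ z))`), and `E` is a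
coordinatewise-monotone neighbourhood of Milnor's join when `Σ |λⱼ|² < T'`; so by `PhamBrieskornJoinBounded.bijective_map_inclusion_fibre_inter`
**`e` followed by the inclusion is bijective on `H_k(·; M)` for every `k` and all coefficients**.

* `localFibre_lam_ne_zero`, `localFibre_point`, `localFibre_mem`, `localFibre_smul_mem_target`, `localFibre_inv_affine`,
  `localFibre_inv_mem_target`, `localFibre_inv_spec`, `localFibre_inv_apply` (verbatim the nodal statements with `2 ↦ aⱼ`);
* `exists_localFibreChart` — the map `e : C(A, F_a)` with its formula and the bijectivity on `H_k(·; M)`.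

Everything is proved; no definitions (`NodalPencil.pencilFibre` is reused), no named facts. Honest scope: plumbing of the classical
construction of the geometric monodromy of a pencil near an isolated weighted-homogeneous singular point; nothing here says HC or any
rung is proved.

## References

* [Milnor1968] J. Milnor, Singular Points of Complex Hypersurfaces, §9 Lemma 9.2, Lemma 9.4, Thm. 9.1.
* [ArnoldGuseinzadeVarchenko2012] V. I. Arnold, S. M. Gusein-Zade, A. N. Varchenko, Singularities of Differentiable Maps II (2012),
  Part I §2.1, §2.3.
-/

noncomputable section

open CategoryTheory AlgebraicGeometry MvPolynomial TopologicalSpace Set Topology Filter Complex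
open scoped Manifold ContDiff Real
open Literature.AlgebraicGeometry.Motives Literature.AlgebraicGeometry.Motives.UniversalHypersurface
open Literature.AlgebraicGeometry.HodgeTheory.UniversalHypersurface Literature.Geometry.ComplexAnalytic
open Literature.AlgebraicTopology.SingularHomology

namespace Literature.AlgebraicGeometry.HodgeTheory

namespace WeightedPencil

section LocalFibre

variable {n d : ℕ} {i : Fin (n + 2)} (a : Fin (n + 1) → ℕ) (ha : ∀ j, a j ≠ 0) (hd : 0 < d) (b₀ : DegIndex n d → ℂ)
  (Φ : OpenPartialHomeomorph (ComplexPoints (regularTotal ℂ n d)) (({m : DegIndex n d // m ≠ regPowIndex n d i} ⊕ Fin (n + 1)) → ℂ))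
  (hΦ : ⇑Φ = regChartFun n d i) (hΦs : Φ.source = regChartDom n d i) (hΦt : Φ.target = regChartFun n d i '' regChartDom n d i)
  (Θ : OpenPartialHomeomorph (Fin (n + 1) → ℂ) (Fin (n + 1) → ℂ)) {r R''' R'' : ℝ}
  (hr : {z : Fin (n + 1) → ℂ | ∑ j, ‖z j‖ ^ 2 ≤ r ^ 2} ⊆ Θ.target)
  (φ : (Fin (n + 1) → ℂ) → ℂ)
  (hφ : ∀ y, φ y = regChartCoeffVec n d i
    (Sum.elim (fun m : {m : DegIndex n d // m ≠ regPowIndex n d i} => b₀ m.1) y) (regPowIndex n d i) - b₀ (regPowIndex n d i))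
  (hΘφ : ∀ y ∈ Θ.source, ∑ j, (Θ y j) ^ a j = φ y)
  {ρW : ℝ}
  (hns : ∀ c : ℂ, c ≠ 0 → ‖c‖ < ρW →
    SmoothHypersurface.IsNonsingularForm ℂ (formOfCoeffs (b₀ + Pi.single (regPowIndex n d i) c)))
  (hR : R''' < R'') {T' : ℝ} (hT'R : T' ≤ R''') (hT'r : T' ≤ r ^ 2)
  {c : ℂ} (hc0 : c ≠ 0) (hcρ : ‖c‖ < ρW)
  (lam : Fin (n + 1) → ℂ) (hlam : ∀ j, lam j ^ a j = c)
include ha hd hΦ hΦs hΦt hr hφ hΘφ hns hR hT'R hT'r hc0 hcρ hlam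

omit ha hd hΦ hΦs hΦt hr hφ hΘφ hns hR hT'R hT'r hc0 hcρ hlam in
/-- The rescaling constants are non-zero. [cite: Milnor1968, §9 Lemma 9.4] -/
theorem localFibre_lam_ne_zero (ha : ∀ j, a j ≠ 0) (hc0 : c ≠ 0) (hlam : ∀ j, lam j ^ a j = c) (j : Fin (n + 1)) :
    lam j ≠ 0 := by
  intro h
  have := hlam j
  rw [h, zero_pow (ha j)] at this
  exact hc0 this.symm

omit ha hd hΦ hΦt hr hns hT'r hc0 hcρ hlam in
/-- **Data of a point of `A = X_c ∩ {F < T'}`**: it lies in the chart domain, its affine coordinates `y` are in `Θ.source`,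
`Σ|Θ y|² = F`, and `Σ (Θ y)ⱼ² = c`. [cite: Milnor1968, §9 Lemma 9.4] [cite: ArnoldGuseinzadeVarchenko2012, Part I §2.1] -/
theorem localFibre_point {Q : ComplexPoints (regularTotal ℂ n d)} (hQ : Q ∈ NodalPencil.pencilFibre n d i b₀ c)
    (hF : NodalPencil.satRadius n d i Θ R''' R'' Q < T') :
    Q ∈ Φ.source ∧ (fun j => regChartFun n d i Q (Sum.inr j)) ∈ Θ.source ∧
      ∑ j, ‖Θ (fun j => regChartFun n d i Q (Sum.inr j)) j‖ ^ 2 = NodalPencil.satRadius n d i Θ R''' R'' Q ∧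
      ∑ j, (Θ (fun j => regChartFun n d i Q (Sum.inr j))) j ^ a j = c := by
  obtain ⟨hQd, hy, hSig⟩ := NodalPencil.mem_of_satRadius_lt n d i Θ R''' R'' hR (lt_of_lt_of_le hF hT'R)
  refine ⟨hΦs ▸ hQd, hy, hSig, ?_⟩
  rw [hΘφ _ hy, ← hQ.2, NodalPencil.pencilCoord_eq_phi n d i b₀ φ hφ hQd hQ.1]

omit hd hΦ hΦt hr hns hT'r hcρ in
/-- **`e(Q) = (Θ(y(Q))ⱼ / λⱼ)ⱼ` lies in the cut fibre `F ∩ {Σ|λⱼ|²|zⱼ|² < T'}`.** [cite: Milnor1968, §9 Lemma 9.4 and Thm. 9.1] -/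
theorem localFibre_mem {Q : ComplexPoints (regularTotal ℂ n d)} (hQ : Q ∈ NodalPencil.pencilFibre n d i b₀ c)
    (hF : NodalPencil.satRadius n d i Θ R''' R'' Q < T') :
    (fun j => Θ (fun j => regChartFun n d i Q (Sum.inr j)) j / lam j) ∈
      PhamBrieskorn.fibre a ∩ {z : Fin (n + 1) → ℂ | ∑ j, ‖lam j‖ ^ 2 * ‖z j‖ ^ 2 < T'} := by
  obtain ⟨-, -, hSig, hsum⟩ := localFibre_point a b₀ Φ hΦs Θ φ hφ hΘφ hR hT'R hQ hF
  have hl0 := localFibre_lam_ne_zero a lam ha hc0 hlam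
  constructor
  · rw [PhamBrieskorn.mem_fibre]
    have h : ∀ j, (Θ (fun j => regChartFun n d i Q (Sum.inr j)) j / lam j) ^ a j =
        (Θ (fun j => regChartFun n d i Q (Sum.inr j))) j ^ a j / c := fun j => by
      rw [div_pow, hlam j]
    simp_rw [h, ← Finset.sum_div, hsum, div_self hc0]
  · show ∑ j, ‖lam j‖ ^ 2 * ‖Θ (fun j => regChartFun n d i Q (Sum.inr j)) j / lam j‖ ^ 2 < T'
    have h : ∀ j, ‖lam j‖ ^ 2 * ‖Θ (fun j => regChartFun n d i Q (Sum.inr j)) j / lam j‖ ^ 2 =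
        ‖Θ (fun j => regChartFun n d i Q (Sum.inr j)) j‖ ^ 2 := fun j => by
      rw [norm_div, div_pow, ← mul_div_assoc, mul_div_cancel_left₀ _ (pow_ne_zero 2 (norm_ne_zero_iff.mpr (hl0 j)))]
    simp_rw [h, hSig]; exact hF

/-! ### The inverse `z ↦ Φ⁻¹(b'₀, Θ⁻¹(λ z))` -/

omit ha hd hΦ hΦs hΦt hφ hns hR hT'R hc0 hcρ in
/-- **The affine point `y' = Θ⁻¹(λ z)` of a point `z` of the cut fibre**: `y' ∈ Θ.source`, `Θ y' = λ z`, `φ(y') = c`,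
`Σ|Θ y'|² = Σ|λⱼ|²|zⱼ|²`. [cite: Milnor1968, §9 Lemma 9.4] -/
theorem localFibre_inv_affine {z : Fin (n + 1) → ℂ}
    (hz : z ∈ PhamBrieskorn.fibre a ∩ {z : Fin (n + 1) → ℂ | ∑ j, ‖lam j‖ ^ 2 * ‖z j‖ ^ 2 < T'}) :
    Θ.symm (lam * z) ∈ Θ.source ∧ Θ (Θ.symm (lam * z)) = lam * z ∧ φ (Θ.symm (lam * z)) = c ∧
      ∑ j, ‖Θ (Θ.symm (lam * z)) j‖ ^ 2 = ∑ j, ‖lam j‖ ^ 2 * ‖z j‖ ^ 2 := by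
  obtain ⟨-, ht⟩ := NodalPencil.localFibre_smul_mem_target Θ hr hT'r lam hz.2
  have hy : Θ.symm (lam * z) ∈ Θ.source := Θ.map_target ht
  have hΘy : Θ (Θ.symm (lam * z)) = lam * z := Θ.right_inv ht
  refine ⟨hy, hΘy, ?_, ?_⟩
  · rw [← hΘφ _ hy, hΘy]
    have h : ∀ j, (lam * z) j ^ a j = c * z j ^ a j :=
      fun j => by rw [Pi.mul_apply, mul_pow, hlam j]
    simp_rw [h, ← Finset.mul_sum, PhamBrieskorn.mem_fibre.mp hz.1, mul_one]
  · rw [hΘy]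
    exact Finset.sum_congr rfl fun j _ => by rw [Pi.mul_apply, norm_mul, mul_pow]

omit ha hΦ hΦs hR hT'R in
/-- **The coordinate vector `(b'₀, Θ⁻¹(λ z))` lies in `Φ.target`**: the solved form there is the member `b₀ + c·e_{xᵢ^d}`, nonsingular
for `0 < |c| < ρW`. [cite: Milnor1968, §9 Lemma 9.4] -/
theorem localFibre_inv_mem_target {z : Fin (n + 1) → ℂ}
    (hz : z ∈ PhamBrieskorn.fibre a ∩ {z : Fin (n + 1) → ℂ | ∑ j, ‖lam j‖ ^ 2 * ‖z j‖ ^ 2 < T'}) :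
    (Sum.elim (fun m : {m : DegIndex n d // m ≠ regPowIndex n d i} => b₀ m.1) (Θ.symm (lam * z)) :
      ({m : DegIndex n d // m ≠ regPowIndex n d i} ⊕ Fin (n + 1)) → ℂ) ∈ Φ.target := by
  obtain ⟨-, -, hφc, -⟩ := localFibre_inv_affine a Θ hr φ hΘφ hT'r lam hlam hz
  rw [hΦt]
  refine mem_image_regChartFun_of_nonsingular n d i hd _ ?_
  rw [NodalPencil.regChartCoeffVec_slice_eq b₀ φ hφ, hφc]
  exact hns c hc0 hcρ

omit hT'R in
/-- **The inverse point `Q(z) = Φ⁻¹(b'₀, Θ⁻¹(λ z))`**: it lies in `Φ.source` with chart coordinates `(b'₀, Θ⁻¹(λ z))`, belongs to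
`X_c`, has `F(Q(z)) = Σ|λⱼ|²|zⱼ|² < T'`, and `e(Q(z)) = z`. [cite: Milnor1968, §9 Lemma 9.4] -/
theorem localFibre_inv_spec (hT'R : T' ≤ R''') {z : Fin (n + 1) → ℂ}
    (hz : z ∈ PhamBrieskorn.fibre a ∩ {z : Fin (n + 1) → ℂ | ∑ j, ‖lam j‖ ^ 2 * ‖z j‖ ^ 2 < T'}) :
    Φ.symm (Sum.elim (fun m : {m : DegIndex n d // m ≠ regPowIndex n d i} => b₀ m.1) (Θ.symm (lam * z))) ∈ Φ.source ∧
      regChartFun n d i (Φ.symm (Sum.elim (fun m : {m : DegIndex n d // m ≠ regPowIndex n d i} => b₀ m.1)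
        (Θ.symm (lam * z)))) =
        Sum.elim (fun m : {m : DegIndex n d // m ≠ regPowIndex n d i} => b₀ m.1) (Θ.symm (lam * z)) ∧
      Φ.symm (Sum.elim (fun m : {m : DegIndex n d // m ≠ regPowIndex n d i} => b₀ m.1) (Θ.symm (lam * z))) ∈
        NodalPencil.pencilFibre n d i b₀ c ∧
      NodalPencil.satRadius n d i Θ R''' R'' (Φ.symm (Sum.elim (fun m : {m : DegIndex n d // m ≠ regPowIndex n d i} => b₀ m.1)
        (Θ.symm (lam * z)))) = ∑ j, ‖lam j‖ ^ 2 * ‖z j‖ ^ 2 ∧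
      (fun j => Θ (fun j => regChartFun n d i (Φ.symm (Sum.elim (fun m : {m : DegIndex n d // m ≠ regPowIndex n d i} => b₀ m.1)
        (Θ.symm (lam * z)))) (Sum.inr j)) j / lam j) = z := by
  set v : ({m : DegIndex n d // m ≠ regPowIndex n d i} ⊕ Fin (n + 1)) → ℂ :=
    Sum.elim (fun m : {m : DegIndex n d // m ≠ regPowIndex n d i} => b₀ m.1) (Θ.symm (lam * z)) with hv
  have hvt : v ∈ Φ.target := localFibre_inv_mem_target a hd b₀ Φ hΦt Θ hr φ hφ hΘφ hns hT'r hc0 hcρ lam hlam hz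
  obtain ⟨hy, hΘy, hφc, hSig⟩ := localFibre_inv_affine a Θ hr φ hΘφ hT'r lam hlam hz
  have hsrc : Φ.symm v ∈ Φ.source := Φ.map_target hvt
  have hchart : regChartFun n d i (Φ.symm v) = v := by rw [← hΦ]; exact Φ.right_inv hvt
  have hdom : Φ.symm v ∈ regChartDom n d i := hΦs ▸ hsrc
  have haff : (fun j => regChartFun n d i (Φ.symm v) (Sum.inr j)) = Θ.symm (lam * z) := by
    funext j; rw [hchart]; rfl
  have hcoeff : regCoeff ℂ n d (Φ.symm v) = b₀ + Pi.single (regPowIndex n d i) c := by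
    rw [regCoeff_eq_regChartCoeffVec n d i hdom, hchart, hv, NodalPencil.regChartCoeffVec_slice_eq b₀ φ hφ, hφc]
  have hmem : Φ.symm v ∈ NodalPencil.pencilFibre n d i b₀ c := (NodalPencil.mem_pencilFibre_iff_regCoeff_eq b₀ c _).mpr hcoeff
  have hlt : ∑ j, ‖lam j‖ ^ 2 * ‖z j‖ ^ 2 < T' := hz.2
  refine ⟨hsrc, hchart, hmem, ?_, ?_⟩
  · rw [NodalPencil.satRadius_eq_of_le n d i Θ R''' R'' hR hdom (haff ▸ hy) (by rw [haff, hSig]; exact hlt.le.trans hT'R), haff, hSig]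
  · funext j
    rw [haff, hΘy, Pi.mul_apply, mul_div_cancel_left₀ _ (localFibre_lam_ne_zero a lam ha hc0 hlam j)]

omit hd hΦt hr hns hT'r hcρ in
/-- **Left inverse**: `Q(e(Q)) = Q` for `Q ∈ A`. [cite: Milnor1968, §9 Lemma 9.4] -/
theorem localFibre_inv_apply {Q : ComplexPoints (regularTotal ℂ n d)} (hQ : Q ∈ NodalPencil.pencilFibre n d i b₀ c)
    (hF : NodalPencil.satRadius n d i Θ R''' R'' Q < T') :
    Φ.symm (Sum.elim (fun m : {m : DegIndex n d // m ≠ regPowIndex n d i} => b₀ m.1)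
        (Θ.symm (lam * fun j => Θ (fun j => regChartFun n d i Q (Sum.inr j)) j / lam j))) = Q := by
  obtain ⟨hQs, hy, -, -⟩ := localFibre_point a b₀ Φ hΦs Θ φ hφ hΘφ hR hT'R hQ hF
  have hl0 := localFibre_lam_ne_zero a lam ha hc0 hlam
  have hmul : (lam * fun j => Θ (fun j => regChartFun n d i Q (Sum.inr j)) j / lam j) =
      Θ (fun j => regChartFun n d i Q (Sum.inr j)) := by
    funext j; rw [Pi.mul_apply, mul_div_cancel₀ _ (hl0 j)]
  rw [hmul, Θ.left_inv hy]
  have hv : (Sum.elim (fun m : {m : DegIndex n d // m ≠ regPowIndex n d i} => b₀ m.1)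
        (fun j => regChartFun n d i Q (Sum.inr j)) :
      ({m : DegIndex n d // m ≠ regPowIndex n d i} ⊕ Fin (n + 1)) → ℂ) = Φ Q := by
    funext s
    rcases s with m | j
    · rw [Sum.elim_inl, hΦ]
      have h := congrFun (regCoeff_eq_regChartCoeffVec n d i (hΦs ▸ hQs)) m.1
      rw [hQ.1 m, regChartCoeffVec_of_ne n d i _ m.2] at h
      exact h
    · rw [Sum.elim_inr, hΦ]
  rw [hv, Φ.left_inv hQs]

/-! ### The local fibre chart -/

/-- **The local Milnor fibre chart at a weighted-homogeneous singular point.** For `0 < |c| < ρW`, `λⱼ^{aⱼ} = c` with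
`Σ|λⱼ|² < T'` (`T' ≤ min(R''', r²)`), there is a continuous map `e : A → F_a` from `A = X_c ∩ {F < T'}` to the Pham–Brieskorn fibre
`F_a = {Σ zⱼ^{aⱼ} = 1}`, given by `e(Q)ⱼ = Θ(y(Q))ⱼ / λⱼ`, which is **bijective on `H_k(·; M)` for every `k` and every coefficient
module `M`** (a homeomorphism onto the cut fibre `F_a ∩ {Σ|λⱼ|²|zⱼ|² < T'}`, whose inclusion in `F_a` is a homology isomorphism since
the cut contains Milnor's join). [cite: Milnor1968, §9 Lemma 9.2, Lemma 9.4, Thm. 9.1] [cite: ArnoldGuseinzadeVarchenko2012, Part I §2.1] -/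
theorem exists_localFibreChart (hΘc : ContinuousOn Θ Θ.source) (hlamT : ∑ j, ‖lam j‖ ^ 2 < T') :
    ∃ e : C(↥{Q : ↥(NodalPencil.pencilFibre n d i b₀ c) | NodalPencil.satRadius n d i Θ R''' R'' Q.1 < T'},
        ↥(PhamBrieskorn.fibre a)),
      (∀ (R M : Type) [CommRing R] [AddCommGroup M] [Module R M] (k : ℕ),
        Function.Bijective (singularHomology.map R M e k).hom) ∧
      ∀ Q, (e Q : Fin (n + 1) → ℂ) = fun j => Θ (fun j => regChartFun n d i Q.1.1 (Sum.inr j)) j / lam j := by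
  set E : Set (Fin (n + 1) → ℂ) := {z | ∑ j, ‖lam j‖ ^ 2 * ‖z j‖ ^ 2 < T'} with hE_def
  set A : Set ↥(NodalPencil.pencilFibre n d i b₀ c) := {Q | NodalPencil.satRadius n d i Θ R''' R'' Q.1 < T'} with hA_def
  -- the forward map onto the cut fibre
  let e₀ : ↥A → ↥(PhamBrieskorn.fibre a ∩ E) := fun Q =>
    ⟨fun j => Θ (fun j => regChartFun n d i Q.1.1 (Sum.inr j)) j / lam j,
      localFibre_mem a ha b₀ Φ hΦs Θ φ hφ hΘφ hR hT'R hc0 lam hlam Q.1.2 Q.2⟩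
  have he₀c : Continuous e₀ := by
    refine Continuous.subtype_mk (continuous_pi fun j => Continuous.div_const ?_ _) _
    have hval : Continuous fun Q : ↥A => (Q.1.1 : ComplexPoints (regularTotal ℂ n d)) :=
      continuous_subtype_val.comp continuous_subtype_val
    have hy : Continuous fun Q : ↥A => fun j => regChartFun n d i Q.1.1 (Sum.inr j) := by
      have h1 : ContinuousOn (fun x : ComplexPoints (regularTotal ℂ n d) => fun j => Φ x (Sum.inr j)) Φ.source :=
        (continuous_pi fun j => continuous_apply (Sum.inr j)).comp_continuousOn Φ.continuousOn
      have h2 := h1.comp_continuous hval fun Q => (localFibre_point a b₀ Φ hΦs Θ φ hφ hΘφ hR hT'R Q.1.2 Q.2).1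
      rw [hΦ] at h2; exact h2
    have hΘy := hΘc.comp_continuous hy fun Q => (localFibre_point a b₀ Φ hΦs Θ φ hφ hΘφ hR hT'R Q.1.2 Q.2).2.1
    exact (continuous_apply j).comp hΘy
  -- the inverse
  let g₀ : ↥(PhamBrieskorn.fibre a ∩ E) → ↥A := fun z =>
    ⟨⟨Φ.symm (Sum.elim (fun m : {m : DegIndex n d // m ≠ regPowIndex n d i} => b₀ m.1) (Θ.symm (lam * z.1))),
        (localFibre_inv_spec a ha hd b₀ Φ hΦ hΦs hΦt Θ hr φ hφ hΘφ hns hR hT'r hc0 hcρ lam hlam hT'R z.2).2.2.1⟩,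
      by
        show NodalPencil.satRadius n d i Θ R''' R'' _ < T'
        rw [(localFibre_inv_spec a ha hd b₀ Φ hΦ hΦs hΦt Θ hr φ hφ hΘφ hns hR hT'r hc0 hcρ lam hlam hT'R z.2).2.2.2.1]
        exact z.2.2⟩
  have hg₀c : Continuous g₀ := by
    refine Continuous.subtype_mk (Continuous.subtype_mk ?_ _) _
    have hz : Continuous fun z : ↥(PhamBrieskorn.fibre a ∩ E) => lam * z.1 := continuous_const.mul continuous_subtype_val
    have hΘs : Continuous fun z : ↥(PhamBrieskorn.fibre a ∩ E) => Θ.symm (lam * z.1) :=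
      Θ.continuousOn_symm.comp_continuous hz fun z => (NodalPencil.localFibre_smul_mem_target Θ hr hT'r lam z.2.2).2
    have hv : Continuous fun z : ↥(PhamBrieskorn.fibre a ∩ E) =>
        (Sum.elim (fun m : {m : DegIndex n d // m ≠ regPowIndex n d i} => b₀ m.1) (Θ.symm (lam * z.1)) :
          ({m : DegIndex n d // m ≠ regPowIndex n d i} ⊕ Fin (n + 1)) → ℂ) := by
      refine continuous_pi fun s => ?_
      rcases s with m | j
      · exact continuous_const
      · exact (continuous_apply j).comp hΘs
    exact Φ.continuousOn_symm.comp_continuous hv fun z =>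
      localFibre_inv_mem_target a hd b₀ Φ hΦt Θ hr φ hφ hΘφ hns hT'r hc0 hcρ lam hlam z.2
  -- the homeomorphism `A ≃ₜ F ∩ E`
  let η : ↥A ≃ₜ ↥(PhamBrieskorn.fibre a ∩ E) :=
    { toFun := e₀
      invFun := g₀
      left_inv := fun Q => Subtype.ext (Subtype.ext
        (localFibre_inv_apply a ha b₀ Φ hΦ hΦs Θ φ hφ hΘφ hR hT'R hc0 lam hlam Q.1.2 Q.2))
      right_inv := fun z => Subtype.ext
        (localFibre_inv_spec a ha hd b₀ Φ hΦ hΦs hΦt Θ hr φ hφ hΘφ hns hR hT'r hc0 hcρ lam hlam hT'R z.2).2.2.2.2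
      continuous_toFun := he₀c
      continuous_invFun := hg₀c }
  let ι : C(↥(PhamBrieskorn.fibre a ∩ E), ↥(PhamBrieskorn.fibre a)) :=
    ⟨Set.inclusion (Set.inter_subset_left : PhamBrieskorn.fibre a ∩ E ⊆ PhamBrieskorn.fibre a), continuous_inclusion _⟩
  refine ⟨ι.comp (η : C(↥A, ↥(PhamBrieskorn.fibre a ∩ E))), fun R M _ _ _ k => ?_, fun Q => rfl⟩
  -- bijectivity on `H_k`: `ι_*` is bijective (the cut contains the join), `η_*` is an isomorphism
  have hE : ∀ z ∈ E, ∀ w : Fin (n + 1) → ℂ, (∀ j, ‖w j‖ ≤ ‖z j‖) → w ∈ E := by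
    intro z hz w hw
    show ∑ j, ‖lam j‖ ^ 2 * ‖w j‖ ^ 2 < T'
    refine lt_of_le_of_lt (Finset.sum_le_sum fun j _ => ?_) hz
    exact mul_le_mul_of_nonneg_left (pow_le_pow_left₀ (norm_nonneg _) (hw j) 2) (sq_nonneg _)
  have hJE : PhamBrieskorn.join a ⊆ E :=
    PhamBrieskorn.join_subset_of_sum_lt ha (lam := fun j => ‖lam j‖ ^ 2) (fun j => sq_nonneg _) hlamT
  have hι := PhamBrieskorn.bijective_map_inclusion_fibre_inter a R M ha hE hJE k
  have hη : Function.Bijective (singularHomology.map R M (η : C(↥A, ↥(PhamBrieskorn.fibre a ∩ E))) k).hom :=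
    (singularHomology.mapIso R M η k).toLinearEquiv.bijective
  rw [singularHomology.map_comp]
  exact hι.comp hη

end LocalFibre

end WeightedPencil

end Literature.AlgebraicGeometry.HodgeTheory

end
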